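import Summits.QuantumFields.YangMills.Theorems.BalabanUVNodesN06Thm312313ParLawsQRow
import Literature.MathematicalPhysics.QuantumFieldTheory.Balaban1983to89.B9LettersHZAtOne

/-!
# BalabanUVNodes ∕ N06 ([B9], `Dag.B9_main`) — CASCADE-K PIECE K2 (director-ym №383): THE DISPLAYED LAWS OF THE ROWS-20∕21 ASSEMBLER
# `…N06Thm312313AtPinsStateSUCLEPar.t312_t313_of_pins_stateSUCLE_par` — PART 3: the law `hqsK` (the letter `Q⋆(U) : 𝔠_Z^{(0), n⁻¹} → 𝔠⁽⁰⁾`) FROM A COLUMN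
# BOUND, and the KNIT LETTER's COLUMN BOUND (the trace-pairing adjoint `adjTrY (QknitY i U)`) on the member's local class (3.35)

Track A of `YM-PLAN.md` (cell `pub-ymgap`, HUMAN RULING D-0062), node **N06** = [Balaban1985BackgroundPropagators] Thms 3.1–3.15; bundle F7 rows 20–21, seat
`pub-ymgap-dag-n06-l` (g37), 2026-08-30.  HONEST FRAMING: finite-dimensional lattice bookkeeping for ONE kinematic letter; a helper for the N06 knit certificate
(the `hqsK` binder of `t312_t313_of_pins_stateSUCLE_par` at the knit pair of record); COUNT-NEUTRAL; N06 NOT discharged; nothing continuum ∕ OS ∕ mass gap ∕ Clay.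

THE PRINT.  [B9] (3.13) p. 393: *«Q\* the adjoint of Q»* for the trace scalar products (3.11); Thm 3.13 p. 426 lists `Q\*`-composites (`G₀Q\*`, `∇_UG₀Q\*`, …) whose
estimates are `G₀`-letters times ONE kinematic letter of `Q\*` — the certificate's displayed `hqsK : HasMaj (weightNorm (ofBlocks blkZ) n⁻¹) (cNorm … blk 0) (𝔬.Qstar U)
(BQ·e^{−δQ d})`.  At the STRAIGHT pair dag-n06-w5 proved it (`B9QstarLettersAtPins.hasMaj_QscoKH`: `|(Q\*μ)(f)| ≤ q_{y′}(f)|μ| ≤ n_{y′}⁻¹|μ|`).  At the KNIT pair of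
record the letter is def-Y's `qsKnitOfRecord N θ i U = adjTrY (QknitY i U)` (the Hermitian adjoint for `Σ tr(ΦᴴΨ)`, `Node00.OpsYQLetter`), read in the `𝔮⋆`-generic model
`QscoKHq i b B cfg 𝔮⋆ U₁ = (cR39 b)⁻¹ • coordOpKH b (𝔮⋆(cfg U₁))` (`Node00.OpsYOps312OfRecordPar`).

WHAT IS PROVED (sorry-free; 0 `def`).
§1 (generic `𝔮⋆`, any carrier): `QscoKHq_apply` (the model unfolded), `abs_QscoKHq_apply_le_of_col` (pointwise bound from a COLUMN bound `‖(𝔮⋆Ψ)(f)‖ ≤ C·Σ_ι k ι f·‖Ψ ι‖`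
at a localised input), ★★ `hasMajorantHom_QscoKHq_of_colKernel` ∕ `hasMaj_QscoKHq_of_colKernel` (w5's two-space ∕ class letters with the flat kernel replaced by any `k ≥ 0` with
`k ι f ≤ K₁·n_ι⁻¹` and `k ι f ≠ 0 ⇒ d(ι, bI f) ≤ ℓ + 4`: majorant `C·K₁·e^{δ(ℓ+4)}·e^{−δd}`, every `δ ≥ 0`).
§2 (the adjoint of a row-majorised letter): ★ `norm_adjTrY_apply_le_of_rowKernel` — if `‖(T a)(ι)‖ ≤ Σ_f k ι f‖a f‖` then `‖(adjTrY T Ψ)(f)‖ ≤ N⁴·Σ_ι k ι f‖Ψ ι‖` (entries of the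
adjoint are trace pairings against `T(δ_f E_{ab})`; `|tr|`-bookkeeping in the `L²`-operator norm); ★★ `hasMaj_QscoKHq_adjTrY_QknitY_of_reg335P` — the class letter of
`Q⋆(U) = adjTrY (QknitY i U)` on the member's local class `(bg9KP …).Reg335 c₀ α₀` with the x-free numerics of PART 2 (`0 < α₀′ ≤ α_Q`, `K_pl(Mα₀)L⁴ < α₀′`): majorant
`N⁴(1 + K_col α₀′)·e^{δ(ℓ+4)}·e^{−δd}` (column sizes `q_ι(f) ≤ n_ι⁻¹` = r03's `qwt_le`, `boxK ι f ≤ n_ι⁻¹` = `boxK_le`).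
§3 ★★★ `hqsK_knit_of_laws` — the assembler's binder `hqsK` VERBATIM at any Sect.-D record whose `Qstar` is pinned to `QscoKHq … (qsKnitOfRecord N θ x.toKIdx)` (`hQsco12`), from the
regime bridge `hRP` and the x-free numerics, with `BQ := N⁴(1 + K_col α₀′)·e^{δQ(ℓ+4)}` at any rate `δQ ≥ 0`.
[cite: Balaban1985BackgroundPropagators, (3.11)–(3.15) p.393, Thm 3.13 p.426 (the letter Q\*), (3.115) p.418, (3.35) p.396; Balaban1985Averaging, Prop. 2 p.26, (139)–(147) pp.39–40;
Balaban1984PropagatorsI, (1.18) p.20; Balaban1984PropagatorsII, (2.51) p.232]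
-/

noncomputable section

namespace Summit.QuantumFields.YangMills.BalabanUVNodes.N06Thm312313ParLawsQStar

open scoped Matrix Matrix.Norms.L2Operator
open Literature.MathematicalPhysics.QuantumFieldTheory.Balaban1983to89
open Literature.MathematicalPhysics.QuantumFieldTheory.Balaban1983to89.Node00
open Literature.MathematicalPhysics.QuantumFieldTheory.Balaban1983to89.B6KLevelCensusIndexV1 (KIdx kGeo)
open Literature.MathematicalPhysics.QuantumFieldTheory.Balaban1983to89.B9PinMembersKLevelV1 (MemberY geo9Y bg9Y)
open Literature.MathematicalPhysics.QuantumFieldTheory.Balaban1983to89.B9BackgroundsKLevelV1R (RegFamY bg9YR MemOfFam mem_of_reg335R)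
open Literature.MathematicalPhysics.QuantumFieldTheory.Balaban1983to89.B7Prop2SpecialUnitary (specialUnitaryUnits specialUnitaryUnits_le_unitaryUnits)
open Literature.MathematicalPhysics.QuantumFieldTheory.Balaban1983to89.B9CoReadingCoordsTranspose (TrIdx trBasis)
open Literature.MathematicalPhysics.QuantumFieldTheory.Balaban1983to89.B9CoReadingCoords (XBK assembleK blkBK)
open Literature.MathematicalPhysics.QuantumFieldTheory.Balaban1983to89.B9CoReadingCoordsH (XHK blkHK coordOpKH_apply)
open Literature.MathematicalPhysics.QuantumFieldTheory.Balaban1983to89.B9Thm312Whole (Ops cNorm GeoOK wt wt_nonneg)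
open Literature.MathematicalPhysics.QuantumFieldTheory.Balaban1983to89.B9Thm39ReadingCoords (cR39 cR39_nonneg coordBound39 basisBound39 abs_repr_le norm_sum_smul_basis_le)
open Literature.MathematicalPhysics.QuantumFieldTheory.Balaban1983to89.Node00.OpsYQLetter (QsLetterY qsKnitOfRecord qsKnitOfRecord_apply adjTrY adjTrY_apply trSesqY unitFnY)
open Literature.MathematicalPhysics.QuantumFieldTheory.Balaban1983to89.Node00.OpsYOps312OfRecordPar (QscoKHq)
open Literature.MathematicalPhysics.QuantumFieldTheory.Balaban1983to89.B6Geom246MultiLevelTorus (geomT)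
open Literature.MathematicalPhysics.QuantumFieldTheory.Balaban1983to89.B6GlobalChartV1 (blkV1)
open Literature.MathematicalPhysics.QuantumFieldTheory.Balaban1983to89.B6RandomWalkHom (HasMajorantHom)
open Literature.MathematicalPhysics.QuantumFieldTheory.Balaban1983to89.B6Ineq2142KLevelV1 (lvl β qwt qwt_nonneg qwt_le)
open Literature.MathematicalPhysics.QuantumFieldTheory.Balaban1983to89.B9GeoNormsKLevelV1 (geo9K geo9K_dist_nonneg)
open Literature.MathematicalPhysics.QuantumFieldTheory.Balaban1983to89.B9GeoLemma21KLevelV1 (geo9K_dist_comm geo9K_len_pos geo9Y_dist_triangle geo9Y_dist_comm geo9Y_len_pos)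
open Literature.MathematicalPhysics.QuantumFieldTheory.Balaban1983to89.B9Thm34Ext (toB6)
open Literature.MathematicalPhysics.QuantumFieldTheory.Balaban1983to89.B9SectDSup (weightNorm)
open Literature.MathematicalPhysics.QuantumFieldTheory.Balaban1983to89.B11SectG (HasMaj BlockNorm)
open Literature.MathematicalPhysics.QuantumFieldTheory.Balaban1983to89.B9LettersHZAtOne (plateau_pos)
open Literature.MathematicalPhysics.QuantumFieldTheory.Balaban1983to89.B9QstarLettersAtPins (reading_const_collapse assembleK_eq_zero_of_loc)
open Literature.MathematicalPhysics.QuantumFieldTheory.Balaban1983to89.B9Eq316AveragingTransposeZd (alphaQ)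
open Literature.MathematicalPhysics.QuantumFieldTheory.Balaban1983to89.B9Eq3115KnitLetterY (QknitY)
open Literature.MathematicalPhysics.QuantumFieldTheory.Balaban1983to89.B9Eq3115KnitLetterYOnto (kCol kCol_nonneg)
open Literature.MathematicalPhysics.QuantumFieldTheory.Balaban1983to89.B9Eq3115KnitLetterYRowCloseness (boxK boxK_nonneg boxK_le)
open Literature.MathematicalPhysics.QuantumFieldTheory.Balaban1983to89.B9C2FormBoxRegimeY (Kpl)
open Literature.MathematicalPhysics.QuantumFieldTheory.Balaban1983to89.B9BackgroundsKLevelV1P (bg9KP)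
open Literature.MathematicalPhysics.QuantumFieldTheory.Balaban1983to89.B7Prop2Explicit (unitaryUnits)
open Summit.QuantumFields.YangMills.BalabanUVNodes.N06Thm312313ParLawsQRow (dist_le_of_knitRow_ne_zero_bI norm_QknitY_apply_le_sum_knitRow)

variable {N : ℕ}

/-! ## §0 Fibre bookkeeping in the `L²`-operator norm -/

section Fibre

/-- an entry is bounded by the `L²`-operator norm. [cite: Balaban1985BackgroundPropagators, p.389 (matrix-valued functions), bookkeeping] -/
private theorem norm_entry_le_l2_opNorm (A : Matrix (Fin N) (Fin N) ℂ) (a a' : Fin N) : ‖A a a'‖ ≤ ‖A‖ := by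
  have h := Matrix.l2_opNorm_mulVec A (EuclideanSpace.single a' (1 : ℂ))
  have h1 : ‖(EuclideanSpace.single a' (1 : ℂ))‖ = 1 := by simp
  rw [h1, mul_one] at h
  refine le_trans ?_ h
  refine le_trans (le_of_eq ?_) (PiLp.norm_apply_le _ a)
  simp

/-- a matrix unit `E_{pq}(c)` has operator norm `≤ ‖c‖`. [cite: Balaban1985BackgroundPropagators, p.389 (matrix units), bookkeeping] -/
private theorem l2_opNorm_single_le (p q : Fin N) (c : ℂ) : ‖Matrix.single p q c‖ ≤ ‖c‖ := by
  set T := Matrix.toEuclideanCLM (n := Fin N) (𝕜 := ℂ) (Matrix.single p q c)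
  rw [← Matrix.l2_opNorm_toEuclideanCLM]
  refine T.opNorm_le_bound (norm_nonneg c) fun y => ?_
  have hmv : ∀ w : Fin N → ℂ, Matrix.single p q c *ᵥ w = Pi.single p (c * w q) := by
    intro w
    funext i
    simp only [Matrix.mulVec, dotProduct, Matrix.single_apply]
    by_cases hi : i = p
    · subst hi
      rw [Pi.single_eq_same, Finset.sum_eq_single q]
      · rw [if_pos ⟨rfl, rfl⟩]
      · intro j _ hj; rw [if_neg (fun h => hj h.2.symm), zero_mul]
      · intro h; exact absurd (Finset.mem_univ _) h
    · rw [Pi.single_eq_of_ne hi]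
      exact Finset.sum_eq_zero fun j _ => by rw [if_neg (fun h => hi h.1.symm), zero_mul]
  have hT : T y = EuclideanSpace.single p (c * y q) := by
    apply (WithLp.ofLp_injective (p := 2))
    rw [Matrix.ofLp_toEuclideanCLM, hmv]
    rfl
  rw [hT]
  calc ‖EuclideanSpace.single p (c * y q)‖ = ‖c * y q‖ := by simp
    _ = ‖c‖ * ‖y q‖ := norm_mul _ _
    _ ≤ ‖c‖ * ‖y‖ := mul_le_mul_of_nonneg_left (PiLp.norm_apply_le y q) (norm_nonneg c)

/-- the operator norm is at most the sum of the entries' moduli. [cite: Balaban1985BackgroundPropagators, p.389, bookkeeping] -/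
private theorem l2_opNorm_le_sum_norm_entry (M : Matrix (Fin N) (Fin N) ℂ) : ‖M‖ ≤ ∑ p, ∑ q, ‖M p q‖ := by
  conv_lhs => rw [Matrix.matrix_eq_sum_single M]
  exact (norm_sum_le _ _).trans (Finset.sum_le_sum fun p _ => (norm_sum_le _ _).trans
    (Finset.sum_le_sum fun q _ => l2_opNorm_single_le p q (M p q)))

end Fibre

/-! ## §1 The law `hqsK` from a COLUMN BOUND, for a generic letter `𝔮⋆` read in def-Y's `𝔮⋆`-generic coordinate model `QscoKHq` -/

section Generic

variable {𝔸 : Type} [NormedRing 𝔸] [NormedAlgebra ℂ 𝔸] [CompleteSpace 𝔸] [FiniteDimensional ℝ 𝔸]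
variable {κ : Type} [Fintype κ]
variable {d ℓ : ℕ} {hd : 1 ≤ d + 1} {hL : Odd (ℓ + 1) ∧ 1 < ℓ + 1} {b₀ b₁ : ℝ}
variable (i : KIdx d ℓ hd hL b₀ b₁) (b : Module.Basis κ ℝ 𝔸) (B : B9.Backgrounds) (cfg : B.Cfg → CfgY 𝔸 i) (𝔮s : QsLetterY 𝔸 i)
variable {bI : FBondY i → IBondY i}

/-- ★ **THE `𝔮⋆`-GENERIC MODEL, UNFOLDED**: `(QscoKHq … 𝔮⋆ U₁ μ)(f, ν, c, c′) = (cR39 b)⁻¹ · repr_c ((𝔮⋆(U₁) w)(f))` with `w_ι = Σ_a μ(ι, ν, a, c′)·b_a` the re-assembled slice.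
[cite: Balaban1985BackgroundPropagators, (3.13) p.393, (3.115) p.418, p.389 (dictionary)] -/
theorem QscoKHq_apply (U₁ : B.Cfg) (μ : XHK κ i → ℝ) (p : XBK κ i) :
    QscoKHq i b B cfg 𝔮s U₁ μ p = (cR39 b)⁻¹ * b.repr (𝔮s (cfg U₁) (assembleK b p.2.1 p.2.2.2 μ) p.1) p.2.2.1 := by
  simp only [QscoKHq, LinearMap.smul_apply, Pi.smul_apply, smul_eq_mul, coordOpKH_apply, LinearMap.restrictScalars_apply]

/-- ★ **THE POINTWISE BOUND FROM A COLUMN BOUND**: if `‖(𝔮⋆(U₁)Ψ)(f)‖ ≤ C·Σ_ι k ι f·‖Ψ ι‖` with `k, C ≥ 0`, then for `μ` localised at the coarse bond `y′`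
`|(QscoKHq … μ)(f, ν, c, c′)| ≤ C·k y′ f · ((cR39 b)⁻¹·coordBound·basisBound·Σ_a |μ(y′, ν, a, c′)|)`. [cite: Balaban1985BackgroundPropagators, (3.13)–(3.15) p.393, p.389 (dictionary)] -/
theorem abs_QscoKHq_apply_le_of_col (U₁ : B.Cfg) (k : IBondY i → FBondY i → ℝ) (hk : ∀ ι f, 0 ≤ k ι f) {C : ℝ} (hC : 0 ≤ C)
    (hcol : ∀ (Ψ : IBondY i → 𝔸) (f : FBondY i), ‖𝔮s (cfg U₁) Ψ f‖ ≤ C * ∑ ι, k ι f * ‖Ψ ι‖)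
    {μ : XHK κ i → ℝ} {y' : IBondY i} (hoff : ∀ q : XHK κ i, q.1 ≠ y' → μ q = 0) (p : XBK κ i) :
    |QscoKHq i b B cfg 𝔮s U₁ μ p| ≤
      C * k y' p.1 * ((cR39 b)⁻¹ * (coordBound39 b * (basisBound39 b * ∑ a, |μ (y', p.2.1, a, p.2.2.2)|))) := by
  classical
  rw [QscoKHq_apply i b B cfg 𝔮s U₁ μ p]
  have hc0 : 0 ≤ (cR39 b)⁻¹ := inv_nonneg.mpr (cR39_nonneg b)
  have hcb : 0 ≤ coordBound39 b := norm_nonneg _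
  set S : 𝔸 := 𝔮s (cfg U₁) (assembleK b p.2.1 p.2.2.2 μ) p.1 with hS
  have hloc : ∑ ι, k ι p.1 * ‖assembleK b p.2.1 p.2.2.2 μ ι‖ = k y' p.1 * ‖assembleK b p.2.1 p.2.2.2 μ y'‖ := by
    rw [Finset.sum_eq_single y']
    · intro ι _ hι
      rw [assembleK_eq_zero_of_loc i b hoff p.2.1 p.2.2.2 hι, norm_zero, mul_zero]
    · intro h; exact absurd (Finset.mem_univ y') h
  have hSn : ‖S‖ ≤ C * (k y' p.1 * (basisBound39 b * ∑ a, |μ (y', p.2.1, a, p.2.2.2)|)) := by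
    refine (hcol _ _).trans ?_
    rw [hloc]
    exact mul_le_mul_of_nonneg_left (mul_le_mul_of_nonneg_left (norm_sum_smul_basis_le b _) (hk _ _)) hC
  have hrepr : |b.repr S p.2.2.1| ≤ coordBound39 b * ‖S‖ := abs_repr_le b S p.2.2.1
  rw [abs_mul, abs_of_nonneg hc0]
  calc (cR39 b)⁻¹ * |b.repr S p.2.2.1| ≤ (cR39 b)⁻¹ * (coordBound39 b * (C * (k y' p.1 * (basisBound39 b * ∑ a, |μ (y', p.2.1, a, p.2.2.2)|)))) :=
        mul_le_mul_of_nonneg_left (hrepr.trans (mul_le_mul_of_nonneg_left hSn hcb)) hc0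
    _ = _ := by ring

/-- ★★ **`Q⋆(U₁)` IN COORDINATES IS A LOCAL, BOUNDED TWO-SPACE OPERATOR FOR ANY COLUMN KERNEL** (w5's `hasMajorantHom_QscoKH` with the flat kernel replaced by `k`): from the coarse
bonds `XHK` (`blkHK`) to the fine bonds `XBK` (`blkBK bI`, `bI` 1-faithful), majorant `C·K₁·n_{y′}⁻¹·e^{δ(ℓ+4)}·e^{−δd(y,y′)}` for every `δ ≥ 0` — `k ≥ 0` with `k ι f ≤ K₁·n_ι⁻¹`,
vanishing unless `d(ι, bI f) ≤ ℓ + 4`, reading constant collapsing. [cite: Balaban1985BackgroundPropagators, (3.13)–(3.15) p.393, (3.110) p.417, Thm 3.13 p.426 (the letter Q\*); Balaban1984PropagatorsII, (2.51) p.232] -/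
theorem hasMajorantHom_QscoKHq_of_colKernel
    (hβ1 : ∀ f : FBondY i, (geomT i.D).dist (β i.hN i.D i.hk (bI f)) (blkV1 i.hN i.D f) ≤ 1) {U₁ : B.Cfg}
    (k : IBondY i → FBondY i → ℝ) (hk : ∀ ι f, 0 ≤ k ι f)
    (hsupp : ∀ ι f, k ι f ≠ 0 → (geo9K i).dist ι (bI f) ≤ (ℓ : ℝ) + 4) {K₁ : ℝ} (hK₁ : 0 ≤ K₁)
    (hkle : ∀ ι f, k ι f ≤ K₁ * ((((ℓ + 1 : ℕ) : ℝ) ^ (d + 1)) ^ lvl i.hN i.D i.hk ι)⁻¹) {C : ℝ} (hC : 0 ≤ C)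
    (hcol : ∀ (Ψ : IBondY i → 𝔸) (f : FBondY i), ‖𝔮s (cfg U₁) Ψ f‖ ≤ C * ∑ ι, k ι f * ‖Ψ ι‖)
    {δ : ℝ} (hδ : 0 ≤ δ) (R₀ : ℝ) (H₀ : Prop) [Fintype (geo9K i).Site] :
    HasMajorantHom (g := toB6 (geo9K i) R₀ H₀) (blkHK i) (blkBK i bI) (QscoKHq i b B cfg 𝔮s U₁)
      (fun a a' => C * K₁ * ((((ℓ + 1 : ℕ) : ℝ) ^ (d + 1)) ^ lvl i.hN i.D i.hk a')⁻¹ *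
        (Real.exp (δ * ((ℓ : ℝ) + 4)) * Real.exp (-(δ * (geo9K i).dist a a')))) := by
  have _ := hβ1
  intro y' μ Bμ hμ p
  change IBondY i at y'
  have hoff : ∀ q : XHK κ i, q.1 ≠ y' → μ q = 0 := fun q hq => hμ.off q hq
  have hsum : ∑ a, |μ (y', p.2.1, a, p.2.2.2)| ≤ (Fintype.card κ : ℝ) * Bμ := by
    calc ∑ a, |μ (y', p.2.1, a, p.2.2.2)| ≤ ∑ _a : κ, Bμ := Finset.sum_le_sum fun a _ => hμ.bound _ rfl
      _ = (Fintype.card κ : ℝ) * Bμ := by rw [Finset.sum_const, nsmul_eq_mul, Finset.card_univ]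
  have hk0 : 0 ≤ C * k y' p.1 := mul_nonneg hC (hk _ _)
  have hpt : |QscoKHq i b B cfg 𝔮s U₁ μ p| ≤ C * k y' p.1 * Bμ := by
    refine (abs_QscoKHq_apply_le_of_col i b B cfg 𝔮s U₁ k hk hC hcol hoff p).trans (mul_le_mul_of_nonneg_left ?_ hk0)
    refine le_trans ?_ (reading_const_collapse b hμ.nonneg)
    exact mul_le_mul_of_nonneg_left (mul_le_mul_of_nonneg_left (mul_le_mul_of_nonneg_left hsum
      (Finset.sum_nonneg fun _ _ => norm_nonneg _)) (norm_nonneg _)) (inv_nonneg.mpr (cR39_nonneg b))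
  have hpl0 : 0 ≤ ((((ℓ + 1 : ℕ) : ℝ) ^ (d + 1)) ^ lvl i.hN i.D i.hk y')⁻¹ := by positivity
  have hK0 : 0 ≤ C * K₁ * ((((ℓ + 1 : ℕ) : ℝ) ^ (d + 1)) ^ lvl i.hN i.D i.hk y')⁻¹ *
      (Real.exp (δ * ((ℓ : ℝ) + 4)) * Real.exp (-(δ * (geo9K i).dist (blkBK i bI p) y'))) := by positivity
  by_cases hq : k y' p.1 = 0
  · rw [hq, mul_zero, zero_mul] at hpt
    exact hpt.trans (mul_nonneg hK0 hμ.nonneg)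
  · have hnear : (geo9K i).dist (bI p.1) y' ≤ (ℓ : ℝ) + 4 := by
      rw [geo9K_dist_comm]; exact hsupp _ _ hq
    have hK1 : 1 ≤ Real.exp (δ * ((ℓ : ℝ) + 4)) * Real.exp (-(δ * (geo9K i).dist (blkBK i bI p) y')) := by
      rw [← Real.exp_add]
      refine Real.one_le_exp ?_
      change 0 ≤ δ * ((ℓ : ℝ) + 4) + -(δ * (geo9K i).dist (bI p.1) y')
      nlinarith [mul_le_mul_of_nonneg_left hnear hδ]
    calc |QscoKHq i b B cfg 𝔮s U₁ μ p| ≤ C * k y' p.1 * Bμ := hpt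
      _ ≤ C * (K₁ * ((((ℓ + 1 : ℕ) : ℝ) ^ (d + 1)) ^ lvl i.hN i.D i.hk y')⁻¹) * 1 * Bμ := by
          rw [mul_one]; exact mul_le_mul_of_nonneg_right (mul_le_mul_of_nonneg_left (hkle _ _) hC) hμ.nonneg
      _ ≤ C * (K₁ * ((((ℓ + 1 : ℕ) : ℝ) ^ (d + 1)) ^ lvl i.hN i.D i.hk y')⁻¹) *
            (Real.exp (δ * ((ℓ : ℝ) + 4)) * Real.exp (-(δ * (geo9K i).dist (blkBK i bI p) y'))) * Bμ :=
          mul_le_mul_of_nonneg_right (mul_le_mul_of_nonneg_left hK1 (by positivity)) hμ.nonneg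
      _ = _ := by ring

/-- ★★ **THE CLASS LETTER OF `Q⋆(U₁)` FROM A COLUMN KERNEL** (w5's `hasMaj_QscoKH`, kernel-generic): `Q⋆(U₁) : 𝔠_Z^{(0), n⁻¹} → 𝔠⁽⁰⁾` — from the `n⁻¹`-weighted sharp-block sup class of
`XHK` (`weightNorm (ofBlocks blkHK) n⁻¹`) into `𝔠⁽⁰⁾` of `XBK` (`cNorm … (blkBK bI) _ 0`) — with majorant `C·K₁·e^{δ(ℓ+4)}·e^{−δd(y,y′)}`, every `δ ≥ 0`.
[cite: Balaban1985BackgroundPropagators, (3.12)–(3.15) p.393, (3.110) p.417, Thm 3.13 p.426; Balaban1984PropagatorsII, (2.51) p.232] -/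
theorem hasMaj_QscoKHq_of_colKernel
    (hβ1 : ∀ f : FBondY i, (geomT i.D).dist (β i.hN i.D i.hk (bI f)) (blkV1 i.hN i.D f) ≤ 1) {U₁ : B.Cfg}
    (k : IBondY i → FBondY i → ℝ) (hk : ∀ ι f, 0 ≤ k ι f)
    (hsupp : ∀ ι f, k ι f ≠ 0 → (geo9K i).dist ι (bI f) ≤ (ℓ : ℝ) + 4) {K₁ : ℝ} (hK₁ : 0 ≤ K₁)
    (hkle : ∀ ι f, k ι f ≤ K₁ * ((((ℓ + 1 : ℕ) : ℝ) ^ (d + 1)) ^ lvl i.hN i.D i.hk ι)⁻¹) {C : ℝ} (hC : 0 ≤ C)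
    (hcol : ∀ (Ψ : IBondY i → 𝔸) (f : FBondY i), ‖𝔮s (cfg U₁) Ψ f‖ ≤ C * ∑ ι, k ι f * ‖Ψ ι‖)
    {δ : ℝ} (hδ : 0 ≤ δ) {R₀ : ℝ} {H₀ : Prop} [Fintype (geo9K i).Site] (hlen : ∀ y : (geo9K i).Site, 0 ≤ (geo9K i).len y)
    (hpl : ∀ y : (geo9K i).Site, 0 ≤ ((((ℓ + 1 : ℕ) : ℝ) ^ (d + 1)) ^ lvl i.hN i.D i.hk y)⁻¹) :
    HasMaj (weightNorm (BlockNorm.ofBlocks (toB6 (geo9K i) R₀ H₀) (blkHK i))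
        (fun y => ((((ℓ + 1 : ℕ) : ℝ) ^ (d + 1)) ^ lvl i.hN i.D i.hk y)⁻¹) hpl)
      (cNorm R₀ H₀ (blkBK i bI) hlen 0) (QscoKHq i b B cfg 𝔮s U₁)
      (fun a a' => C * K₁ * Real.exp (δ * ((ℓ : ℝ) + 4)) * Real.exp (-(δ * (geo9K i).dist a a'))) := by
  have hK0 : ∀ a a' : (geo9K i).Site, 0 ≤ C * K₁ * ((((ℓ + 1 : ℕ) : ℝ) ^ (d + 1)) ^ lvl i.hN i.D i.hk a')⁻¹ *
      (Real.exp (δ * ((ℓ : ℝ) + 4)) * Real.exp (-(δ * (geo9K i).dist a a'))) := fun a a' => by positivity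
  have h0 := B9Thm37AllNorms.hasMaj_of_hasMajorantHom (G := toB6 (geo9K i) R₀ H₀) (blkHK i) (blkBK i bI) hK0
    (hasMajorantHom_QscoKHq_of_colKernel i b B cfg 𝔮s hβ1 k hk hsupp hK₁ hkle hC hcol hδ R₀ H₀)
  show HasMaj _ (weightNorm (BlockNorm.ofBlocks (toB6 (geo9K i) R₀ H₀) (blkBK i bI)) (wt (geo9K i) 0) (wt_nonneg hlen 0)) _ _
  refine B9SectDSup.HasMaj.weight hpl (wt_nonneg hlen 0) h0 fun y y' => le_of_eq ?_
  simp only [wt, pow_zero, inv_one, one_mul]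
  have hn : ((((ℓ + 1 : ℕ) : ℝ) ^ (d + 1)) ^ lvl i.hN i.D i.hk y') ≠ 0 := by positivity
  field_simp

end Generic

/-! ## §2 The adjoint of a row-majorised letter is column-majorised; the knit letter `Q⋆(U) = adjTrY (QknitY i U)` on (3.35) -/

section Adjoint

open scoped Matrix

variable {d ℓ : ℕ} {hd : 1 ≤ d + 1} {hL : Odd (ℓ + 1) ∧ 1 < ℓ + 1} {b₀ b₁ : ℝ} (i : KIdx d ℓ hd hL b₀ b₁) {bI : FBondY i → IBondY i}

/-- ★ **THE TRACE-PAIRING ADJOINT OF A ROW-MAJORISED LETTER IS COLUMN-MAJORISED**: if `‖(T a)(ι)‖ ≤ Σ_f k ι f·‖a f‖` (`k ≥ 0`) then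
`‖(adjTrY T Ψ)(f)‖ ≤ N⁴·Σ_ι k ι f·‖Ψ ι‖` — the `(a,b)` entry of `(adjTrY T Ψ)(f)` is `Σ_ι tr((T δ_f E_{ab})(ι)ᴴ Ψ(ι))`, entries are `≤` the operator norm, `‖E_{ab}‖ ≤ 1`.
[cite: Balaban1985BackgroundPropagators, (3.11)–(3.13) p.393 («Q\* the adjoint of Q»), bookkeeping] -/
theorem norm_adjTrY_apply_le_of_rowKernel (T : (FBondY i → Matrix (Fin N) (Fin N) ℂ) →ₗ[ℂ] (IBondY i → Matrix (Fin N) (Fin N) ℂ))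
    (k : IBondY i → FBondY i → ℝ) (hk : ∀ ι f, 0 ≤ k ι f)
    (hrow : ∀ (a : FBondY i → Matrix (Fin N) (Fin N) ℂ) (ι : IBondY i), ‖T a ι‖ ≤ ∑ f, k ι f * ‖a f‖)
    (Ψ : IBondY i → Matrix (Fin N) (Fin N) ℂ) (f : FBondY i) :
    ‖adjTrY T Ψ f‖ ≤ (N : ℝ) ^ 4 * ∑ ι, k ι f * ‖Ψ ι‖ := by
  classical
  -- the image of a matrix unit at `f` has `ι`-th value of norm `≤ k ι f`
  have hTunit : ∀ (a b : Fin N) (ι : IBondY i), ‖T (unitFnY f a b) ι‖ ≤ k ι f := by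
    intro a b ι
    refine (hrow _ ι).trans ?_
    rw [Finset.sum_eq_single f]
    · have h1 : ‖unitFnY f a b f‖ ≤ 1 := by
        rw [unitFnY, Pi.single_eq_same]
        exact (l2_opNorm_single_le a b (1 : ℂ)).trans (le_of_eq norm_one)
      calc k ι f * ‖unitFnY f a b f‖ ≤ k ι f * 1 := mul_le_mul_of_nonneg_left h1 (hk ι f)
        _ = k ι f := mul_one _
    · intro f' _ hf'
      rw [unitFnY, Pi.single_eq_of_ne hf', norm_zero, mul_zero]
    · intro h; exact absurd (Finset.mem_univ f) h
  -- each entry of `(adjTrY T Ψ)(f)` is `≤ N²·Σ_ι k ι f‖Ψ ι‖`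
  have hentry : ∀ a b : Fin N, ‖adjTrY T Ψ f a b‖ ≤ (N : ℝ) ^ 2 * ∑ ι, k ι f * ‖Ψ ι‖ := by
    intro a b
    rw [adjTrY_apply]
    unfold trSesqY
    have hι : ∀ ι, ‖∑ c, ∑ e, star (T (unitFnY f a b) ι c e) * Ψ ι c e‖ ≤ (N : ℝ) ^ 2 * (k ι f * ‖Ψ ι‖) := by
      intro ι
      have hce : ∀ c e : Fin N, ‖star (T (unitFnY f a b) ι c e) * Ψ ι c e‖ ≤ k ι f * ‖Ψ ι‖ := by
        intro c e
        rw [norm_mul, norm_star]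
        exact mul_le_mul ((norm_entry_le_l2_opNorm _ c e).trans (hTunit a b ι)) (norm_entry_le_l2_opNorm _ c e) (norm_nonneg _) (hk ι f)
      calc ‖∑ c, ∑ e, star (T (unitFnY f a b) ι c e) * Ψ ι c e‖ ≤ ∑ c, ‖∑ e, star (T (unitFnY f a b) ι c e) * Ψ ι c e‖ := norm_sum_le _ _
        _ ≤ ∑ c, ∑ e, ‖star (T (unitFnY f a b) ι c e) * Ψ ι c e‖ := Finset.sum_le_sum fun c _ => norm_sum_le _ _
        _ ≤ ∑ _c : Fin N, ∑ _e : Fin N, k ι f * ‖Ψ ι‖ := Finset.sum_le_sum fun c _ => Finset.sum_le_sum fun e _ => hce c e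
        _ = (N : ℝ) ^ 2 * (k ι f * ‖Ψ ι‖) := by
            rw [Finset.sum_const, Finset.card_univ, Fintype.card_fin, Finset.sum_const, Finset.card_univ, Fintype.card_fin, smul_smul,
              nsmul_eq_mul]
            push_cast; ring
    calc ‖∑ ι, ∑ c, ∑ e, star (T (unitFnY f a b) ι c e) * Ψ ι c e‖ ≤ ∑ ι, ‖∑ c, ∑ e, star (T (unitFnY f a b) ι c e) * Ψ ι c e‖ := norm_sum_le _ _
      _ ≤ ∑ ι, (N : ℝ) ^ 2 * (k ι f * ‖Ψ ι‖) := Finset.sum_le_sum fun ι _ => hι ι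
      _ = (N : ℝ) ^ 2 * ∑ ι, k ι f * ‖Ψ ι‖ := by rw [← Finset.mul_sum]
  calc ‖adjTrY T Ψ f‖ ≤ ∑ a, ∑ b, ‖adjTrY T Ψ f a b‖ := l2_opNorm_le_sum_norm_entry _
    _ ≤ ∑ _a : Fin N, ∑ _b : Fin N, (N : ℝ) ^ 2 * ∑ ι, k ι f * ‖Ψ ι‖ := Finset.sum_le_sum fun a _ => Finset.sum_le_sum fun b _ => hentry a b
    _ = (N : ℝ) ^ 4 * ∑ ι, k ι f * ‖Ψ ι‖ := by
        rw [Finset.sum_const, Finset.card_univ, Fintype.card_fin, Finset.sum_const, Finset.card_univ, Fintype.card_fin, smul_smul, nsmul_eq_mul]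
        push_cast; ring

/-- the knit kernel's COLUMN sizes: `q_ι(f) + K_col α₀′·boxK ι f ≤ (1 + K_col α₀′)·n_ι⁻¹`, `n_ι = L^{(d+1)j(ι)}` (r03's `qwt_le`, `boxK_le`).
[cite: Balaban1984PropagatorsI, (1.18) p.20; Balaban1985Averaging, (139)–(147) pp.39–40, bookkeeping] -/
theorem knitRow_le_plateau {α₀' : ℝ} (hα : 0 ≤ α₀') (ι : IBondY i) (f : FBondY i) :
    qwt i.hN i.D i.hk ι f + kCol (d + 1) (ℓ + 1) * α₀' * boxK i ι f
      ≤ (1 + kCol (d + 1) (ℓ + 1) * α₀') * ((((ℓ + 1 : ℕ) : ℝ) ^ (d + 1)) ^ lvl i.hN i.D i.hk ι)⁻¹ := by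
  have hq := qwt_le i.hN i.D i.hk ι f
  have hb : boxK i ι f ≤ ((((ℓ + 1 : ℕ) : ℝ) ^ (d + 1)) ^ lvl i.hN i.D i.hk ι)⁻¹ := by
    have h := boxK_le i ι f
    rwa [← pow_mul, mul_comm, pow_mul] at h
  have hk0 : 0 ≤ kCol (d + 1) (ℓ + 1) * α₀' := mul_nonneg (kCol_nonneg _ _) hα
  rw [add_mul, one_mul]
  exact add_le_add hq (mul_le_mul_of_nonneg_left hb hk0)

variable [Nonempty (Fin N)]

/-- ★★ **THE CLASS LETTER OF `Q⋆(U) = adjTrY (QknitY i U)` ON THE MEMBER's LOCAL CLASS (3.35)**: at def-Y's coordinate model `QscoKHq … 𝔮⋆ U₁` of any letter `𝔮⋆` with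
`𝔮⋆(cfg U₁) = adjTrY (QknitY i (cfg U₁))` (the knit pair of record: `qsKnitOfRecord_apply`), for every member background `cfg U₁` in `(bg9KP …).Reg335 c₀ α₀` (`G ≤ U(N)`, `c₀ ≤ 10`,
`0 ≤ Mα₀`, `0 < α₀′ ≤ α_Q`, `K_pl(Mα₀)·L⁴ < α₀′`): `HasMaj (weightNorm (ofBlocks blkHK) n⁻¹ _) (cNorm R₀ H₀ (blkBK bI) _ 0) (Q⋆) (N⁴(1 + K_col α₀′)·e^{δ(ℓ+4)}·e^{−δd})`, every `δ ≥ 0`.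
[cite: Balaban1985BackgroundPropagators, Thm 3.13 p.426 (the letter Q\*), (3.11)–(3.15) p.393, (3.115) p.418, (3.35) p.396; Balaban1985Averaging, Prop. 2 p.26; Balaban1984PropagatorsII, (2.51) p.232] -/
theorem hasMaj_QscoKHq_adjTrY_QknitY_of_reg335P (hG : GeoOK (geo9K i)) [Fintype (geo9K i).Site]
    (hβ1 : ∀ f : FBondY i, (geomT i.D).dist (β i.hN i.D i.hk (bI f)) (blkV1 i.hN i.D f) ≤ 1)
    {G : Subgroup (Matrix (Fin N) (Fin N) ℂ)ˣ} (hGU : G ≤ unitaryUnits (Matrix (Fin N) (Fin N) ℂ))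
    (B : B9.Backgrounds) (cfg : B.Cfg → CfgY (Matrix (Fin N) (Fin N) ℂ) i) (𝔮s : QsLetterY (Matrix (Fin N) (Fin N) ℂ) i) {U₁ : B.Cfg}
    (h𝔮s : 𝔮s (cfg U₁) = adjTrY (QknitY i (cfg U₁))) {c₀ α₀ : ℝ} (hc : c₀ ≤ 10) (hMα : 0 ≤ (kGeo i).M * α₀)
    (hreg : (bg9KP (Matrix (Fin N) (Fin N) ℂ) G i).Reg335 c₀ α₀ (cfg U₁)) {α₀' : ℝ} (hα' : 0 < α₀') (hαQ : α₀' ≤ alphaQ (d + 1) (ℓ + 1))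
    (hK : Kpl i ((kGeo i).M * α₀) * (kGeo i).L ^ 4 < α₀') {δ : ℝ} (hδ : 0 ≤ δ) {R₀ : ℝ} {H₀ : Prop}
    (hpl : ∀ y : (geo9K i).Site, 0 ≤ ((((ℓ + 1 : ℕ) : ℝ) ^ (d + 1)) ^ lvl i.hN i.D i.hk y)⁻¹) :
    HasMaj (weightNorm (BlockNorm.ofBlocks (toB6 (geo9K i) R₀ H₀) (blkHK i))
        (fun y => ((((ℓ + 1 : ℕ) : ℝ) ^ (d + 1)) ^ lvl i.hN i.D i.hk y)⁻¹) hpl)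
      (cNorm R₀ H₀ (blkBK i bI) hG.lenle 0) (QscoKHq i (trBasis N) B cfg 𝔮s U₁)
      (fun a a' => (N : ℝ) ^ 4 * (1 + kCol (d + 1) (ℓ + 1) * α₀') * Real.exp (δ * ((ℓ : ℝ) + 4)) * Real.exp (-(δ * (geo9K i).dist a a'))) := by
  have hk : ∀ ι f, 0 ≤ qwt i.hN i.D i.hk ι f + kCol (d + 1) (ℓ + 1) * α₀' * boxK i ι f :=
    fun ι f => add_nonneg (qwt_nonneg _ _ _ _ _) (mul_nonneg (mul_nonneg (kCol_nonneg _ _) hα'.le) (boxK_nonneg i ι f))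
  have hcol : ∀ (Ψ : IBondY i → Matrix (Fin N) (Fin N) ℂ) (f : FBondY i),
      ‖𝔮s (cfg U₁) Ψ f‖ ≤ (N : ℝ) ^ 4 * ∑ ι, (qwt i.hN i.D i.hk ι f + kCol (d + 1) (ℓ + 1) * α₀' * boxK i ι f) * ‖Ψ ι‖ := by
    intro Ψ f
    rw [h𝔮s]
    exact norm_adjTrY_apply_le_of_rowKernel i (QknitY i (cfg U₁)) _ hk (norm_QknitY_apply_le_sum_knitRow i hGU hc hMα hreg hα' hαQ hK) Ψ f
  have hK₁ : 0 ≤ 1 + kCol (d + 1) (ℓ + 1) * α₀' := by have := kCol_nonneg (d + 1) (ℓ + 1); positivity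
  exact hasMaj_QscoKHq_of_colKernel i (trBasis N) B cfg 𝔮s hβ1 _ hk (fun _ _ h => dist_le_of_knitRow_ne_zero_bI i hβ1 h) hK₁
    (knitRow_le_plateau i hα'.le) (by positivity) hcol hδ hG.lenle hpl

end Adjoint

/-! ## §3 The assembler's binder `hqsK` at the knit pair of record -/

section KnitBinder

open scoped Matrix

variable {N : ℕ} [Nonempty (Fin N)] (θ : Stage3Params) (Mstar : ℕ) {R₁ R₂ : RegFamY θ.d₆ θ.ℓ₆ θ.hd' θ.hL' θ.b₀ θ.b₁ Mstar (Matrix (Fin N) (Fin N) ℂ)} {c : ℝ}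
variable [∀ x : MemberY θ.d₆ θ.ℓ₆ θ.hd' θ.hL' θ.b₀ θ.b₁ Mstar, Fintype (geo9Y x).Site]

/-- ★★★ **THE CERTIFICATE's BINDER `hqsK` AT THE KNIT PAIR, FROM THE DISPLAYED REGIME BRIDGE AND X-FREE NUMERICS**: at any Sect.-D record `𝔬12` whose `Qstar` is pinned to def-Y's
`QscoKHq … (qsKnitOfRecord N θ x.toKIdx)` (`hQsco12`) with block maps `blkBK (bI x) ∕ blkHK` (`hblk12 ∕ hblkZ12`), over the class-parametric carrier: the regime bridge `hRP` (the
carrier's class at `c` refines the member's local class `(bg9KP … SU(N) …).Reg335 c₀`, `c₀ ≤ 10`), the x-free knit numerics `0 < α₀′ ≤ α_Q`, `hKpl : 0 ≤ a ≤ a12 ⇒ K_pl(a)·L⁴ < α₀′`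
and `0 < M12` give `t312_t313_of_pins_stateSUCLE_par`'s `hqsK` VERBATIM at any rate `δQ ≥ 0` with `BQ := N⁴(1 + K_col α₀′)·e^{δQ(ℓ+4)}`.
[cite: Balaban1985BackgroundPropagators, Thm 3.13 p.426 (the letter Q\*), (3.13) p.393, (3.115) p.418, (3.35) p.396; Balaban1985Averaging, Prop. 2 p.26; Balaban1984PropagatorsII, (2.51) p.232] -/
theorem hqsK_knit_of_laws
    {W12 : MemberY θ.d₆ θ.ℓ₆ θ.hd' θ.hL' θ.b₀ θ.b₁ Mstar → Type} [∀ x, Fintype (W12 x)]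
    (𝔬12 : ∀ x : MemberY θ.d₆ θ.ℓ₆ θ.hd' θ.hL' θ.b₀ θ.b₁ Mstar, Ops (geo9Y x) (bg9YR (Matrix (Fin N) (Fin N) ℂ) (specialUnitaryUnits (Fin N)) R₁ R₂ x) (XBK (TrIdx N) x.toKIdx) (XBK (TrIdx N) x.toKIdx) (XHK (TrIdx N) x.toKIdx) (W12 x))
    (bI : ∀ x : MemberY θ.d₆ θ.ℓ₆ θ.hd' θ.hL' θ.b₀ θ.b₁ Mstar, FBondY x.toKIdx → IBondY x.toKIdx)
    (hβ1 : ∀ (x : MemberY θ.d₆ θ.ℓ₆ θ.hd' θ.hL' θ.b₀ θ.b₁ Mstar) (f : FBondY x.toKIdx), (geomT x.D).dist (β x.hN x.D x.hk (bI x f)) (blkV1 x.hN x.D f) ≤ 1)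
    (H12 : MemberY θ.d₆ θ.ℓ₆ θ.hd' θ.hL' θ.b₀ θ.b₁ Mstar → Prop)
    (hblk12 : ∀ x : MemberY θ.d₆ θ.ℓ₆ θ.hd' θ.hL' θ.b₀ θ.b₁ Mstar, (𝔬12 x).blk = blkBK x.toKIdx (bI x)) (hblkZ12 : ∀ x : MemberY θ.d₆ θ.ℓ₆ θ.hd' θ.hL' θ.b₀ θ.b₁ Mstar, (𝔬12 x).blkZ = blkHK x.toKIdx)
    (hQsco12 : ∀ (x : MemberY θ.d₆ θ.ℓ₆ θ.hd' θ.hL' θ.b₀ θ.b₁ Mstar) (U : (bg9YR (Matrix (Fin N) (Fin N) ℂ) (specialUnitaryUnits (Fin N)) R₁ R₂ x).Cfg),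
      (𝔬12 x).Qstar U = QscoKHq x.toKIdx (trBasis N) (bg9YR (Matrix (Fin N) (Fin N) ℂ) (specialUnitaryUnits (Fin N)) R₁ R₂ x) (fun U => U) (qsKnitOfRecord N θ x.toKIdx) U)
    {M12 a12 : ℝ} (hM12 : 0 < M12) {δQ : ℝ} (hδQ : 0 ≤ δQ)
    {c₀ : ℝ} (hc : c₀ ≤ 10)
    (hRP : ∀ (x : MemberY θ.d₆ θ.ℓ₆ θ.hd' θ.hL' θ.b₀ θ.b₁ Mstar) (α₀ : ℝ) (U : (bg9YR (Matrix (Fin N) (Fin N) ℂ) (specialUnitaryUnits (Fin N)) R₁ R₂ x).Cfg),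
      (bg9YR (Matrix (Fin N) (Fin N) ℂ) (specialUnitaryUnits (Fin N)) R₁ R₂ x).Reg335 c α₀ U → (bg9KP (Matrix (Fin N) (Fin N) ℂ) (specialUnitaryUnits (Fin N)) x.toKIdx).Reg335 c₀ α₀ U)
    {α₀' : ℝ} (hα' : 0 < α₀') (hαQ : α₀' ≤ alphaQ (θ.d₆ + 1) (θ.ℓ₆ + 1))
    (hKpl : ∀ (x : MemberY θ.d₆ θ.ℓ₆ θ.hd' θ.hL' θ.b₀ θ.b₁ Mstar) (a : ℝ), 0 ≤ a → a ≤ a12 → Kpl x.toKIdx a * (kGeo x.toKIdx).L ^ 4 < α₀') :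
    ∀ x : MemberY θ.d₆ θ.ℓ₆ θ.hd' θ.hL' θ.b₀ θ.b₁ Mstar, M12 ≤ (geo9Y x).M → ∀ α₀ : ℝ, 0 < α₀ → (geo9Y x).M * α₀ ≤ a12 →
      ∀ U : (bg9YR (Matrix (Fin N) (Fin N) ℂ) (specialUnitaryUnits (Fin N)) R₁ R₂ x).Cfg, (bg9YR (Matrix (Fin N) (Fin N) ℂ) (specialUnitaryUnits (Fin N)) R₁ R₂ x).Reg335 c α₀ U →
        HasMaj (weightNorm (BlockNorm.ofBlocks (toB6 (geo9Y x) 1 (H12 x)) (𝔬12 x).blkZ) (fun y => ((((θ.ℓ₆ + 1 : ℕ) : ℝ) ^ (θ.d₆ + 1)) ^ lvl x.hN x.D x.hk y)⁻¹) (fun y => (plateau_pos x.toKIdx y).le))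
          (cNorm 1 (H12 x) (𝔬12 x).blk (fun y => (geo9Y_len_pos x y).le) 0) ((𝔬12 x).Qstar U)
          (fun a a' => ((N : ℝ) ^ 4 * (1 + kCol (θ.d₆ + 1) (θ.ℓ₆ + 1) * α₀') * Real.exp (δQ * ((θ.ℓ₆ : ℝ) + 4))) * Real.exp (-(δQ * (geo9Y x).dist a a'))) := by
  intro x hM α₀ hα ha U hU
  letI : Fintype (geo9K x.toKIdx).Site := (inferInstance : Fintype (geo9Y x).Site)
  have hgeo : GeoOK (geo9Y x) := ⟨geo9Y_dist_triangle x, geo9Y_dist_comm x, geo9K_dist_nonneg x.toKIdx, geo9Y_len_pos x⟩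
  have hMx : 0 ≤ (geo9Y x).M := hM12.le.trans hM
  have hMα : 0 ≤ (kGeo x.toKIdx).M * α₀ := mul_nonneg hMx hα.le
  have hKx : Kpl x.toKIdx ((kGeo x.toKIdx).M * α₀) * (kGeo x.toKIdx).L ^ 4 < α₀' := hKpl x _ hMα ha
  have h := hasMaj_QscoKHq_adjTrY_QknitY_of_reg335P x.toKIdx hgeo (hβ1 x) specialUnitaryUnits_le_unitaryUnits
    (bg9YR (Matrix (Fin N) (Fin N) ℂ) (specialUnitaryUnits (Fin N)) R₁ R₂ x) (fun U => U) (qsKnitOfRecord N θ x.toKIdx) (U₁ := U)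
    (show qsKnitOfRecord N θ x.toKIdx U = adjTrY (QknitY x.toKIdx U) from rfl) hc hMα (hRP x α₀ U hU) hα' hαQ hKx hδQ (R₀ := (1 : ℝ)) (H₀ := H12 x) (fun y => (plateau_pos x.toKIdx y).le)
  rw [hblk12 x, hblkZ12 x, hQsco12 x U]
  exact h

end KnitBinder

end Summit.QuantumFields.YangMills.BalabanUVNodes.N06Thm312313ParLawsQStar

end
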